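import Summits.QuantumFields.BalabanUV.T4Continuum.Support.ShellMeasureDecayKernelSums

/-!
# `T4Continuum.ShellMeasureDecayKernelComp` — E6-SHAPE DECAY ROWS ARE CLOSED UNDER KERNEL COMPOSITION (the `kerOp`∕`compKer`
# currency of S66 f3a): the composite of two exponentially localised operator-valued kernels is exponentially localised at ANY
# smaller rate, the middle sum being paid by the surplus rate — the WRS-product ∕ [B6] (2.68) mechanism for RECTANGULAR,
# OPERATOR-VALUED kernels on PLACED index sets
(cell `pub-balaban`, sub-cell `t4`, spine estimate NE7c (node U5b); NE7c ROUND-2 crew, unit `b2b-balaban-t4-ne7c-formalise-leaf-06`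
gen 10; post-v6 ESTIMATE LANE, offered as junction piece «J7 — E2∕E3 COMPOSITION ALGEBRA» for the owner's (α)-programme residual
«E2∕E3: the Sect. D algebra of `H₁ = G₁𝔓*`, `H` via WRS products» (R-ne7cp1-g37-7 (a)); ADDITIVE — imports S66 f3a
`ShellMeasureDecayKernelSums` (`kerOp`, `compKer`, `kerOp_comp`, `sum_exp_pl1_comp_le`) ONLY; [folklore]; 0 `def`, 0 `def … : Prop`,
0 sorry, 0 citation tags; touches NO host, moves NO census row)

HONEST FRAMING.  Finite four-torus programme, rung (B)+1 only — NOT infinite volume, NOT a mass gap, NOT the Clay problem, NOT summit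
progress.  NE7c (`T4IndicatorShell.ShellWeightBound`) is NOT PRINTED in [Balaban 1983–89] and NOT PROVED; «NE7c ⇐ the named binders»
(THE ONE CALL of record v4 p238484, 84 displayed [T]; v5 63).  ELEMENTARY bookkeeping on OUR side (finite sums, the triangle inequality of
the placing distance); nothing about Bałaban's minimisers, propagators or kernels is computed, asserted, cited or discharged; the analogous
algebra exists in the tree in two OTHER currencies — square scalar matrices (`B13PerturbativeStep.WRS.mul`, `B6KernelComposition.mul_decay`
on `ℤᵈ`) and block-normed linear maps (`B11SectG.hasMaj_comp_exp`) — and `B6KernelComposition.conv_prefactor_witness` records why the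
rate MUST drop; this file is the same step for the hosts' E6 rows `∀ V c b′, ‖k V c b′‖ ≤ c·e^{−δ·dis (pos c) (pos b′)}` (rectangular,
entries `𝔄 →L[𝕜] 𝔅`, index sets placed by `pos` in a set `𝔖` with a distance-like `dis`).  HONEST DEPENDENCY (cell): continuum YM on
T⁴ ⇐ BetaPertH ∧ nine spine estimates (0/9 proved); BetaPertH ⇐ (D1) ∧ (D4) ∧ CAP+tail; G-an2-4 gates asym, D1 and NE2/3/4.

CONTENT (kernel, 0 sorry).  §1 `norm_compKer_le` (the entrywise Schur bound `‖(k₁ ⋆ k₂) e b‖ ≤ Σ_c ‖k₁ e c‖·‖k₂ c b‖`) and the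
exponential bookkeeping `exp_mul_exp_le_of_triangle`.  §2 `decay_of_finite_range` (a kernel of range `r` bounded by `c₀` is E6-localised at EVERY
rate `δ ≥ 0` with constant `c₀e^{δr}` — how a block-averaging adjoint enters); **`compKer_decay`**: on a set `𝔖` with `dis ≥ 0` and the triangle inequality,
`‖k₁ e c‖ ≤ c₁e^{−δ₁·dis(pos″e, pos′c)}`, `‖k₂ c b‖ ≤ c₂e^{−δ₂·dis(pos′c, pos b)}`, `0 ≤ δ ≤ min δ₁ δ₂` and the REDUCED-RATE uniform sum
over the middle indices `∀ x, Σ_c e^{−(δ₁−δ)·dis(x, pos′c)} ≤ M` ⟹ **`‖(k₁ ⋆ k₂) e b‖ ≤ c₁c₂M·e^{−δ·dis(pos″e, pos b)}`**; the mirror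
`compKer_decay'` pays with the INPUT-side sum `∀ y, Σ_c e^{−(δ₂−δ)·dis(pos′c, y)} ≤ M`; the FAMILY form `compKer_decay_family`
(`∀ V`, the hosts' literal row shape in, the same shape out).  §3 **`compKer_decay_torus`**: `𝔖 := TPt d T`, `dis := pl1(· − ·)` (the
coarse-blocked reading of record, S110), middle fibres `≤ m` per cell ⟹ constant `c₁c₂·(m·K₁ d (δ₁ − δ))` for every `0 ≤ δ < δ₁`,
`δ ≤ δ₂` — NO `#Λ′`, NO volume (`sum_exp_pl1_comp_le` BY NAME); `kerOp_comp_decay_torus`: the same read on the OPERATORS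
(`kerOp k₁ (kerOp k₂ A) = kerOp (k₁ ⋆ k₂) A`, S66 f3a).  §4 `rate_must_drop`: two rate-`δ` kernels on a three-point line whose composite
has entry `3·e^{−2δ}` at distance `2` — strictly above `e^{−2δ}`, so NO absolute constant keeps the rate (cf. `conv_prefactor_witness`).
USE (the owner labels∕books∕vetoes): an E2∕E3-type letter that node O identifies as a PRODUCT of E6-localised letters (e.g. `H₁ = G₁𝔓*` with
`𝔓*` of finite range) inherits an E6 row BY NAME, with the displayed constant `c₁c₂M` and any rate below both factors'.
-/

noncomputable section

namespace Summit.QuantumFields.BalabanUV.T4Continuum.ShellMeasureDecayKernelComp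

open Literature.MathematicalPhysics.QuantumFieldTheory.Balaban1983to89
open ShellMeasureDecayKernelSums (kerOp compKer kerOp_comp_apply sum_exp_pl1_comp_le)
open B12Decay510Window (K₁)
open TreeLengthTorus (TPt)
open B12Decay510Torus (pl1 pl1_nonneg pl1_sub_triangle)

variable {𝕜 : Type*} [RCLike 𝕜] {Λ Λ' Λ'' : Type*}
variable {𝔄 𝔅 ℭ : Type*} [NormedAddCommGroup 𝔄] [NormedSpace 𝕜 𝔄] [NormedAddCommGroup 𝔅] [NormedSpace 𝕜 𝔅]
  [NormedAddCommGroup ℭ] [NormedSpace 𝕜 ℭ]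

/-! ## §1 The entrywise Schur bound of a composite kernel and the exponential bookkeeping -/

/-- `‖(k₁ ⋆ k₂) e b‖ ≤ Σ_c ‖k₁ e c‖·‖k₂ c b‖`. [folklore] -/
theorem norm_compKer_le [Fintype Λ'] (k₁ : Λ'' → Λ' → (𝔅 →L[𝕜] ℭ)) (k₂ : Λ' → Λ → (𝔄 →L[𝕜] 𝔅)) (e : Λ'') (b : Λ) :
    ‖compKer k₁ k₂ e b‖ ≤ ∑ c, ‖k₁ e c‖ * ‖k₂ c b‖ :=
  (norm_sum_le _ _).trans (Finset.sum_le_sum fun _ _ => ContinuousLinearMap.opNorm_comp_le _ _)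

/-- **The surplus-rate bookkeeping**: for `0 ≤ δ ≤ δ₁`, `δ ≤ δ₂`, `0 ≤ D₂` and `D ≤ D₁ + D₂`,
`e^{−δ₁D₁}·e^{−δ₂D₂} ≤ e^{−(δ₁−δ)D₁}·e^{−δD}`. [folklore] -/
theorem exp_mul_exp_le_of_triangle {δ δ₁ δ₂ D D₁ D₂ : ℝ} (hδ : 0 ≤ δ) (hδ₂ : δ ≤ δ₂) (hD₂ : 0 ≤ D₂)
    (htri : D ≤ D₁ + D₂) :
    Real.exp (-(δ₁ * D₁)) * Real.exp (-(δ₂ * D₂)) ≤ Real.exp (-((δ₁ - δ) * D₁)) * Real.exp (-(δ * D)) := by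
  rw [← Real.exp_add, ← Real.exp_add]
  apply Real.exp_le_exp.mpr
  nlinarith [mul_le_mul_of_nonneg_left htri hδ, mul_le_mul_of_nonneg_right hδ₂ hD₂]

/-- The mirror bookkeeping (surplus taken from the SECOND factor): `0 ≤ δ ≤ δ₁`, `0 ≤ D₁`, `D ≤ D₁ + D₂` ⟹
`e^{−δ₁D₁}·e^{−δ₂D₂} ≤ e^{−δD}·e^{−(δ₂−δ)D₂}`. [folklore] -/
theorem exp_mul_exp_le_of_triangle' {δ δ₁ δ₂ D D₁ D₂ : ℝ} (hδ : 0 ≤ δ) (hδ₁ : δ ≤ δ₁) (hD₁ : 0 ≤ D₁)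
    (htri : D ≤ D₁ + D₂) :
    Real.exp (-(δ₁ * D₁)) * Real.exp (-(δ₂ * D₂)) ≤ Real.exp (-(δ * D)) * Real.exp (-((δ₂ - δ) * D₂)) := by
  rw [← Real.exp_add, ← Real.exp_add]
  apply Real.exp_le_exp.mpr
  nlinarith [mul_le_mul_of_nonneg_left htri hδ, mul_le_mul_of_nonneg_right hδ₁ hD₁]

/-! ## §2 The composite of two localised kernels is localised at any smaller rate -/

section Decay

variable {S : Type*}

/-- **A FINITE-RANGE KERNEL IS E6-LOCALISED AT EVERY RATE**: `‖k c b‖ ≤ c₀`, `k c b = 0` unless `dis(pos′c, pos b) ≤ r`, `δ ≥ 0` ⟹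
`‖k c b‖ ≤ c₀e^{δr}·e^{−δ·dis(pos′c, pos b)}` (the shape in which a block-averaging adjoint `𝔓*` of range `r` enters a composite).
[folklore] -/
theorem decay_of_finite_range (k : Λ' → Λ → (𝔄 →L[𝕜] 𝔅)) (dis : S → S → ℝ) (pos' : Λ' → S) (pos : Λ → S) {c₀ r δ : ℝ}
    (hc₀ : 0 ≤ c₀) (hδ : 0 ≤ δ) (hk : ∀ c b, ‖k c b‖ ≤ c₀) (hrange : ∀ c b, k c b ≠ 0 → dis (pos' c) (pos b) ≤ r) (c : Λ')
    (b : Λ) : ‖k c b‖ ≤ c₀ * Real.exp (δ * r) * Real.exp (-(δ * dis (pos' c) (pos b))) := by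
  by_cases h0 : k c b = 0
  · rw [h0, norm_zero]; positivity
  · have h1 : 1 ≤ Real.exp (δ * r) * Real.exp (-(δ * dis (pos' c) (pos b))) := by
      rw [← Real.exp_add]
      exact Real.one_le_exp (by nlinarith [hrange c b h0])
    calc ‖k c b‖ ≤ c₀ * 1 := by rw [mul_one]; exact hk c b
      _ ≤ c₀ * (Real.exp (δ * r) * Real.exp (-(δ * dis (pos' c) (pos b)))) := mul_le_mul_of_nonneg_left h1 hc₀
      _ = _ := by ring

/-- **E6-SHAPE ROWS ARE CLOSED UNDER COMPOSITION** (middle sum paid on the OUTPUT side).  `dis ≥ 0` with the triangle inequality;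
`‖k₁ e c‖ ≤ c₁e^{−δ₁dis(pos″e, pos′c)}`, `‖k₂ c b‖ ≤ c₂e^{−δ₂dis(pos′c, pos b)}` (`c₁, c₂ ≥ 0`); `0 ≤ δ ≤ δ₂`; the reduced-rate
uniform sum over the middle indices `∀ x, Σ_c e^{−(δ₁−δ)dis(x, pos′c)} ≤ M` ⟹ `‖(k₁ ⋆ k₂) e b‖ ≤ c₁c₂M·e^{−δ·dis(pos″e, pos b)}`.
[folklore] -/
theorem compKer_decay [Fintype Λ'] (k₁ : Λ'' → Λ' → (𝔅 →L[𝕜] ℭ)) (k₂ : Λ' → Λ → (𝔄 →L[𝕜] 𝔅)) (dis : S → S → ℝ)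
    (pos'' : Λ'' → S) (pos' : Λ' → S) (pos : Λ → S) (hdis : ∀ x y, 0 ≤ dis x y) (htri : ∀ x y z, dis x z ≤ dis x y + dis y z)
    {c₁ c₂ δ₁ δ₂ δ M : ℝ} (hc₁ : 0 ≤ c₁) (hc₂ : 0 ≤ c₂) (hδ : 0 ≤ δ) (hδ₂ : δ ≤ δ₂)
    (h₁ : ∀ e c, ‖k₁ e c‖ ≤ c₁ * Real.exp (-(δ₁ * dis (pos'' e) (pos' c))))
    (h₂ : ∀ c b, ‖k₂ c b‖ ≤ c₂ * Real.exp (-(δ₂ * dis (pos' c) (pos b))))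
    (hM : ∀ x : S, ∑ c, Real.exp (-((δ₁ - δ) * dis x (pos' c))) ≤ M) (e : Λ'') (b : Λ) :
    ‖compKer k₁ k₂ e b‖ ≤ c₁ * c₂ * M * Real.exp (-(δ * dis (pos'' e) (pos b))) := by
  have hE : ∀ c, ‖k₁ e c‖ * ‖k₂ c b‖ ≤
      c₁ * c₂ * (Real.exp (-((δ₁ - δ) * dis (pos'' e) (pos' c))) * Real.exp (-(δ * dis (pos'' e) (pos b)))) := fun c =>
    calc ‖k₁ e c‖ * ‖k₂ c b‖
        ≤ (c₁ * Real.exp (-(δ₁ * dis (pos'' e) (pos' c)))) * (c₂ * Real.exp (-(δ₂ * dis (pos' c) (pos b)))) :=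
          mul_le_mul (h₁ e c) (h₂ c b) (norm_nonneg _) (mul_nonneg hc₁ (Real.exp_pos _).le)
      _ = c₁ * c₂ * (Real.exp (-(δ₁ * dis (pos'' e) (pos' c))) * Real.exp (-(δ₂ * dis (pos' c) (pos b)))) := by ring
      _ ≤ c₁ * c₂ * (Real.exp (-((δ₁ - δ) * dis (pos'' e) (pos' c))) * Real.exp (-(δ * dis (pos'' e) (pos b)))) :=
          mul_le_mul_of_nonneg_left (exp_mul_exp_le_of_triangle hδ hδ₂ (hdis _ _) (htri _ _ _)) (mul_nonneg hc₁ hc₂)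
  calc ‖compKer k₁ k₂ e b‖ ≤ ∑ c, ‖k₁ e c‖ * ‖k₂ c b‖ := norm_compKer_le k₁ k₂ e b
    _ ≤ ∑ c, c₁ * c₂ * (Real.exp (-((δ₁ - δ) * dis (pos'' e) (pos' c))) * Real.exp (-(δ * dis (pos'' e) (pos b)))) :=
        Finset.sum_le_sum fun c _ => hE c
    _ = c₁ * c₂ * (∑ c, Real.exp (-((δ₁ - δ) * dis (pos'' e) (pos' c)))) * Real.exp (-(δ * dis (pos'' e) (pos b))) := by
        rw [← Finset.mul_sum, ← Finset.sum_mul]; ring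
    _ ≤ c₁ * c₂ * M * Real.exp (-(δ * dis (pos'' e) (pos b))) :=
        mul_le_mul_of_nonneg_right (mul_le_mul_of_nonneg_left (hM (pos'' e)) (mul_nonneg hc₁ hc₂)) (Real.exp_pos _).le

/-- **E6-SHAPE ROWS ARE CLOSED UNDER COMPOSITION** (middle sum paid on the INPUT side): as `compKer_decay` with `0 ≤ δ ≤ δ₁` and the
reduced-rate uniform sum `∀ y, Σ_c e^{−(δ₂−δ)dis(pos′c, y)} ≤ M`. [folklore] -/
theorem compKer_decay' [Fintype Λ'] (k₁ : Λ'' → Λ' → (𝔅 →L[𝕜] ℭ)) (k₂ : Λ' → Λ → (𝔄 →L[𝕜] 𝔅)) (dis : S → S → ℝ)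
    (pos'' : Λ'' → S) (pos' : Λ' → S) (pos : Λ → S) (hdis : ∀ x y, 0 ≤ dis x y) (htri : ∀ x y z, dis x z ≤ dis x y + dis y z)
    {c₁ c₂ δ₁ δ₂ δ M : ℝ} (hc₁ : 0 ≤ c₁) (hc₂ : 0 ≤ c₂) (hδ : 0 ≤ δ) (hδ₁ : δ ≤ δ₁)
    (h₁ : ∀ e c, ‖k₁ e c‖ ≤ c₁ * Real.exp (-(δ₁ * dis (pos'' e) (pos' c))))
    (h₂ : ∀ c b, ‖k₂ c b‖ ≤ c₂ * Real.exp (-(δ₂ * dis (pos' c) (pos b))))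
    (hM : ∀ y : S, ∑ c, Real.exp (-((δ₂ - δ) * dis (pos' c) y)) ≤ M) (e : Λ'') (b : Λ) :
    ‖compKer k₁ k₂ e b‖ ≤ c₁ * c₂ * M * Real.exp (-(δ * dis (pos'' e) (pos b))) := by
  have hE : ∀ c, ‖k₁ e c‖ * ‖k₂ c b‖ ≤
      c₁ * c₂ * (Real.exp (-(δ * dis (pos'' e) (pos b))) * Real.exp (-((δ₂ - δ) * dis (pos' c) (pos b)))) := fun c =>
    calc ‖k₁ e c‖ * ‖k₂ c b‖
        ≤ (c₁ * Real.exp (-(δ₁ * dis (pos'' e) (pos' c)))) * (c₂ * Real.exp (-(δ₂ * dis (pos' c) (pos b)))) :=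
          mul_le_mul (h₁ e c) (h₂ c b) (norm_nonneg _) (mul_nonneg hc₁ (Real.exp_pos _).le)
      _ = c₁ * c₂ * (Real.exp (-(δ₁ * dis (pos'' e) (pos' c))) * Real.exp (-(δ₂ * dis (pos' c) (pos b)))) := by ring
      _ ≤ c₁ * c₂ * (Real.exp (-(δ * dis (pos'' e) (pos b))) * Real.exp (-((δ₂ - δ) * dis (pos' c) (pos b)))) :=
          mul_le_mul_of_nonneg_left (exp_mul_exp_le_of_triangle' hδ hδ₁ (hdis _ _) (htri _ _ _)) (mul_nonneg hc₁ hc₂)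
  calc ‖compKer k₁ k₂ e b‖ ≤ ∑ c, ‖k₁ e c‖ * ‖k₂ c b‖ := norm_compKer_le k₁ k₂ e b
    _ ≤ ∑ c, c₁ * c₂ * (Real.exp (-(δ * dis (pos'' e) (pos b))) * Real.exp (-((δ₂ - δ) * dis (pos' c) (pos b)))) :=
        Finset.sum_le_sum fun c _ => hE c
    _ = c₁ * c₂ * (∑ c, Real.exp (-((δ₂ - δ) * dis (pos' c) (pos b)))) * Real.exp (-(δ * dis (pos'' e) (pos b))) := by
        rw [← Finset.mul_sum, ← Finset.mul_sum]; ring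
    _ ≤ c₁ * c₂ * M * Real.exp (-(δ * dis (pos'' e) (pos b))) :=
        mul_le_mul_of_nonneg_right (mul_le_mul_of_nonneg_left (hM (pos b)) (mul_nonneg hc₁ hc₂)) (Real.exp_pos _).le

/-- **THE FAMILY FORM** (the hosts' literal E6 row shape `∀ V c b′, ‖k V c b′‖ ≤ c·e^{−δ·dis (pos c) (pos b′)}` IN, the same shape OUT
for the fibrewise composite). [folklore] -/
theorem compKer_decay_family {𝒱 : Type*} [Fintype Λ'] (k₁ : 𝒱 → Λ'' → Λ' → (𝔅 →L[𝕜] ℭ)) (k₂ : 𝒱 → Λ' → Λ → (𝔄 →L[𝕜] 𝔅))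
    (dis : S → S → ℝ) (pos'' : Λ'' → S) (pos' : Λ' → S) (pos : Λ → S) (hdis : ∀ x y, 0 ≤ dis x y)
    (htri : ∀ x y z, dis x z ≤ dis x y + dis y z) {c₁ c₂ δ₁ δ₂ δ M : ℝ} (hc₁ : 0 ≤ c₁) (hc₂ : 0 ≤ c₂) (hδ : 0 ≤ δ)
    (hδ₂ : δ ≤ δ₂) (h₁ : ∀ V e c, ‖k₁ V e c‖ ≤ c₁ * Real.exp (-(δ₁ * dis (pos'' e) (pos' c))))
    (h₂ : ∀ V c b, ‖k₂ V c b‖ ≤ c₂ * Real.exp (-(δ₂ * dis (pos' c) (pos b))))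
    (hM : ∀ x : S, ∑ c, Real.exp (-((δ₁ - δ) * dis x (pos' c))) ≤ M) :
    ∀ V e b, ‖compKer (k₁ V) (k₂ V) e b‖ ≤ c₁ * c₂ * M * Real.exp (-(δ * dis (pos'' e) (pos b))) := fun V =>
  compKer_decay (k₁ V) (k₂ V) dis pos'' pos' pos hdis htri hc₁ hc₂ hδ hδ₂ (h₁ V) (h₂ V) hM

end Decay

/-! ## §3 The torus instance: `dis = pl1(· − ·)`, volume-free constant -/

section Torus

variable {d T : ℕ} [NeZero T] [Fintype Λ']

/-- **COMPOSITION ON THE CELL TORUS `(ℤ∕Tℤ)ᵈ`, VOLUME-FREE**: `dis x y := pl1 (x − y)` (the coarse-blocked reading of record), middle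
indices placed with fibres `≤ m`, decay of the factors at rates `δ₁, δ₂` with constants `c₁, c₂ ≥ 0`; then for every `0 ≤ δ < δ₁`,
`δ ≤ δ₂`: `‖(k₁ ⋆ k₂) e b‖ ≤ c₁c₂·(m·K₁ d (δ₁ − δ))·e^{−δ·pl1(pos″e − pos b)}` — NO `#Λ′`, NO `T`. [folklore] -/
theorem compKer_decay_torus (k₁ : Λ'' → Λ' → (𝔅 →L[𝕜] ℭ)) (k₂ : Λ' → Λ → (𝔄 →L[𝕜] 𝔅)) (pos'' : Λ'' → TPt d T)
    (pos' : Λ' → TPt d T) (pos : Λ → TPt d T) {m : ℕ} (hm : ∀ x, (Finset.univ.filter fun c => pos' c = x).card ≤ m)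
    {c₁ c₂ δ₁ δ₂ δ : ℝ} (hc₁ : 0 ≤ c₁) (hc₂ : 0 ≤ c₂) (hδ : 0 ≤ δ) (hδ₁ : δ < δ₁) (hδ₂ : δ ≤ δ₂)
    (h₁ : ∀ e c, ‖k₁ e c‖ ≤ c₁ * Real.exp (-(δ₁ * pl1 (pos'' e - pos' c))))
    (h₂ : ∀ c b, ‖k₂ c b‖ ≤ c₂ * Real.exp (-(δ₂ * pl1 (pos' c - pos b)))) (e : Λ'') (b : Λ) :
    ‖compKer k₁ k₂ e b‖ ≤ c₁ * c₂ * (m * K₁ d (δ₁ - δ)) * Real.exp (-(δ * pl1 (pos'' e - pos b))) :=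
  compKer_decay k₁ k₂ (fun x y => pl1 (x - y)) pos'' pos' pos (fun _ _ => pl1_nonneg _) (fun x y z => pl1_sub_triangle x y z)
    hc₁ hc₂ hδ hδ₂ h₁ h₂ (fun x => sum_exp_pl1_comp_le pos' hm (sub_pos.mpr hδ₁) x) e b

/-- **… READ ON THE OPERATORS**: `‖(kerOp k₁ (kerOp k₂ A)) e‖` is the `e`-row of `kerOp (k₁ ⋆ k₂) A` (S66 f3a `kerOp_comp_apply`), so the
composite OPERATOR is the kernel operator of an E6-localised kernel with the constant and rate of `compKer_decay_torus`. [folklore] -/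
theorem kerOp_comp_decay_torus [Fintype Λ] (k₁ : Λ'' → Λ' → (𝔅 →L[𝕜] ℭ)) (k₂ : Λ' → Λ → (𝔄 →L[𝕜] 𝔅))
    (pos'' : Λ'' → TPt d T) (pos' : Λ' → TPt d T) (pos : Λ → TPt d T) {m : ℕ}
    (hm : ∀ x, (Finset.univ.filter fun c => pos' c = x).card ≤ m) {c₁ c₂ δ₁ δ₂ δ : ℝ} (hc₁ : 0 ≤ c₁) (hc₂ : 0 ≤ c₂)
    (hδ : 0 ≤ δ) (hδ₁ : δ < δ₁) (hδ₂ : δ ≤ δ₂) (h₁ : ∀ e c, ‖k₁ e c‖ ≤ c₁ * Real.exp (-(δ₁ * pl1 (pos'' e - pos' c))))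
    (h₂ : ∀ c b, ‖k₂ c b‖ ≤ c₂ * Real.exp (-(δ₂ * pl1 (pos' c - pos b)))) :
    ∃ k : Λ'' → Λ → (𝔄 →L[𝕜] ℭ), (∀ A, kerOp k₁ (kerOp k₂ A) = kerOp k A) ∧
      ∀ e b, ‖k e b‖ ≤ c₁ * c₂ * (m * K₁ d (δ₁ - δ)) * Real.exp (-(δ * pl1 (pos'' e - pos b))) :=
  ⟨compKer k₁ k₂, fun A => kerOp_comp_apply k₁ k₂ A, compKer_decay_torus k₁ k₂ pos'' pos' pos hm hc₁ hc₂ hδ hδ₁ hδ₂ h₁ h₂⟩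

end Torus

/-! ## §4 The rate must drop -/

/-- **NO ABSOLUTE CONSTANT KEEPS THE RATE**: on the three-point line `{0, 1, 2} ⊂ ℝ` with `dis = |· − ·|`, the scalar kernels
`k(i,j) := e^{−δ|i−j|}` (rate `δ`, constant `1`) compose to a kernel whose `(0, 2)` entry has norm `3·e^{−2δ}` — three times the
rate-`δ` profile `e^{−2δ}` at that distance (and `n + 1` times on an `n`-line, `B6KernelComposition.conv_prefactor_witness`); so
`compKer_decay`'s surplus rate `δ₁ − δ > 0` is not an artefact. [folklore] -/
theorem rate_must_drop (δ : ℝ) :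
    let k : Fin 3 → Fin 3 → (ℝ →L[ℝ] ℝ) := fun i j => Real.exp (-(δ * |((i : ℕ) : ℝ) - ((j : ℕ) : ℝ)|)) • ContinuousLinearMap.id ℝ ℝ
    ‖compKer k k 0 2‖ = 3 * Real.exp (-(δ * 2)) := by
  intro k
  have hk : ∀ i j : Fin 3, k i j = Real.exp (-(δ * |((i : ℕ) : ℝ) - ((j : ℕ) : ℝ)|)) • ContinuousLinearMap.id ℝ ℝ := fun _ _ => rfl
  have hsum : compKer k k 0 2 = (3 * Real.exp (-(δ * 2))) • ContinuousLinearMap.id ℝ ℝ := by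
    simp only [compKer, Fin.sum_univ_three, hk, ContinuousLinearMap.smul_comp, ContinuousLinearMap.comp_smul,
      ContinuousLinearMap.id_comp, smul_smul, ← add_smul]
    congr 1
    have e01 : |((0 : ℕ) : ℝ) - ((1 : ℕ) : ℝ)| = 1 := by norm_num
    simp only [Fin.val_zero, Fin.val_one, Fin.val_two, Nat.cast_zero, Nat.cast_one, Nat.cast_ofNat]
    rw [show |(0 : ℝ) - 0| = 0 by norm_num, show |(0 : ℝ) - 2| = 2 by norm_num, show |(0 : ℝ) - 1| = 1 by norm_num,
      show |(1 : ℝ) - 2| = 1 by norm_num, show |(2 : ℝ) - 2| = 0 by norm_num, mul_zero, neg_zero, Real.exp_zero,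
      ← Real.exp_add]
    ring_nf
  rw [hsum, norm_smul, ContinuousLinearMap.norm_id, mul_one, Real.norm_eq_abs, abs_of_pos (by positivity)]

end Summit.QuantumFields.BalabanUV.T4Continuum.ShellMeasureDecayKernelComp

end
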